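/-
Copyright: the b2b-balaban T⁴-continuum CRUX team, row NE7b OWNER lineage `t4-ne7b-p1` (gen 144). Project licence.
-/
import Mathlib.MeasureTheory.Integral.Bochner.Basic

/-!
# GLUE FOR THE ORDER-FIVE ENTRY MAJORANT — POINTWISE INTEGRAND PERMUTATIONS (the order-5 block of the kernel-letter CLASS MAP; Mathlib only).
# (596) proved, under the quadruple ROW SUM, the identities moving the tilt factor `A_x` (last in every rule output) to the front where the
# piece files carry it; the ENTRY majorant needs the same identities POINTWISE (one entry at a time): raw covariance symmetry, the centred
# triple cyclic and under two transpositions, `u₄` written out under four permutations, `u₅` written out cyclic — abstract observables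
# `oᵢ : Ω → ℝ`, abstract centres `aᵢ`, weight `e`, normalisation `Zi`, measure `μ`; factors commute inside each integrand and the pair ∕
# pair–triple partitions permute among themselves (row NE7b, node U5c; Mathlib only; [folklore])

Cell `pub-balaban`, sub-cell `t4`, spine estimate NE7b (`T4WeightBudget.RelWeightBound`; the cell's OWN estimate — NOT PRINTED in
[Bałaban 1983–89], NOT PROVED).  Crux-route work under `Spine/NE7b/` by the row OWNER (`t4-ne7b-p1` gen 144, file (606)) under FREEZE
(0)'s crux-prover clause; NOTHING of Bałaban's is named as a Lean object, valued or asserted; no `T4Continuum/Support` leaf typed; no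
`def`, no notation; zero `sorry`.  Imports: Mathlib only.

WHAT IS PROVED ([folklore]): `cov_symm_pt`, `cm3_cyc_pt`, `cm3_swap12_pt`, `cm3_swap13_pt`, `u4_cyc_pt`, `u4_4213_pt`, `u4_swap12_pt`, `u4_3124_pt`,
**`u5_cyc_pt`**; toy.

HONEST (what this is NOT).  Commutativity inside integrands and of real products: NOT a bound on anything.  Scalar skeleton ((A3), NC-NE7b-α
UNRULED); nothing of Bałaban's asserted.  BY-NAME EFFECT ON THE WALL: NONE.  NE7b NOT PRINTED ∕ NOT PROVED; spine PROVED 0∕9; rung (B)+1 — the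
programme's measures remain FINITE-torus statements; NOT the mass gap, NOT Clay.  HONEST DEPENDENCY: continuum YM on T⁴ ⇐ BetaPertH ∧ nine
spine estimates (0∕9 proved); BetaPertH ⇐ (D1) ∧ (D4) ∧ CAP+tail; G-an2-4 gates asym, D1 and NE2∕3∕4.
-/

set_option autoImplicit false

noncomputable section

namespace Summit.QuantumFields.BalabanUV.T4Continuum.NE7b.SupFifthKernelEntryGlue

open MeasureTheory

variable {Ω : Type*} [MeasurableSpace Ω]

/-- **Raw covariance symmetry** (pointwise): `Cov(p,q) = Cov(q,p)` in the raw format. [folklore] -/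
theorem cov_symm_pt (μ : Measure Ω) (e : Ω → ℝ) (Zi Zi2 : ℝ) (p q : Ω → ℝ) :
    Zi * (∫ ω, e ω * (p ω * q ω) ∂μ) - Zi2 * ((∫ ω, e ω * p ω ∂μ) * (∫ ω, e ω * q ω ∂μ)) =
      Zi * (∫ ω, e ω * (q ω * p ω) ∂μ) - Zi2 * ((∫ ω, e ω * q ω ∂μ) * (∫ ω, e ω * p ω ∂μ)) := by
  have i1 : (∫ ω, e ω * (p ω * q ω) ∂μ) = ∫ ω, e ω * (q ω * p ω) ∂μ := integral_congr_ae (Filter.Eventually.of_forall fun ω => by ring)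
  rw [i1, mul_comm (∫ ω, e ω * p ω ∂μ)]

/-- **Centred triple, last factor to the front** (pointwise). [folklore] -/
theorem cm3_cyc_pt (μ : Measure Ω) (e : Ω → ℝ) (Zi : ℝ) (o1 o2 o3 : Ω → ℝ) (a1 a2 a3 : ℝ) :
    (Zi * (∫ ω, e ω * ((o1 ω - a1) * (o2 ω - a2) * (o3 ω - a3)) ∂μ)) =
      (Zi * (∫ ω, e ω * ((o3 ω - a3) * (o1 ω - a1) * (o2 ω - a2)) ∂μ)) := by
  have i1 : (∫ ω, e ω * ((o1 ω - a1) * (o2 ω - a2) * (o3 ω - a3)) ∂μ) =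
      (∫ ω, e ω * ((o3 ω - a3) * (o1 ω - a1) * (o2 ω - a2)) ∂μ) :=
    integral_congr_ae (Filter.Eventually.of_forall fun ω => by ring)
  rw [i1]

/-- **Centred triple, first two factors exchanged** (pointwise). [folklore] -/
theorem cm3_swap12_pt (μ : Measure Ω) (e : Ω → ℝ) (Zi : ℝ) (o1 o2 o3 : Ω → ℝ) (a1 a2 a3 : ℝ) :
    (Zi * (∫ ω, e ω * ((o1 ω - a1) * (o2 ω - a2) * (o3 ω - a3)) ∂μ)) =
      (Zi * (∫ ω, e ω * ((o2 ω - a2) * (o1 ω - a1) * (o3 ω - a3)) ∂μ)) := by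
  have i1 : (∫ ω, e ω * ((o1 ω - a1) * (o2 ω - a2) * (o3 ω - a3)) ∂μ) =
      (∫ ω, e ω * ((o2 ω - a2) * (o1 ω - a1) * (o3 ω - a3)) ∂μ) :=
    integral_congr_ae (Filter.Eventually.of_forall fun ω => by ring)
  rw [i1]

/-- **Centred triple, outer factors exchanged** (pointwise). [folklore] -/
theorem cm3_swap13_pt (μ : Measure Ω) (e : Ω → ℝ) (Zi : ℝ) (o1 o2 o3 : Ω → ℝ) (a1 a2 a3 : ℝ) :
    (Zi * (∫ ω, e ω * ((o1 ω - a1) * (o2 ω - a2) * (o3 ω - a3)) ∂μ)) =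
      (Zi * (∫ ω, e ω * ((o3 ω - a3) * (o2 ω - a2) * (o1 ω - a1)) ∂μ)) := by
  have i1 : (∫ ω, e ω * ((o1 ω - a1) * (o2 ω - a2) * (o3 ω - a3)) ∂μ) =
      (∫ ω, e ω * ((o3 ω - a3) * (o2 ω - a2) * (o1 ω - a1)) ∂μ) :=
    integral_congr_ae (Filter.Eventually.of_forall fun ω => by ring)
  rw [i1]

/-- **`u₄(p,q,r,w) = u₄(w,p,q,r)`** written out (pointwise). [folklore] -/
theorem u4_cyc_pt (μ : Measure Ω) (e : Ω → ℝ) (Zi : ℝ) (o1 o2 o3 o4 : Ω → ℝ) (a1 a2 a3 a4 : ℝ) :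
    ((Zi * (∫ ω, e ω * ((o1 ω - a1) * (o2 ω - a2) * (o3 ω - a3) * (o4 ω - a4)) ∂μ)) - (Zi * (∫ ω, e ω * ((o1 ω - a1) * (o2 ω - a2)) ∂μ)) * (Zi * (∫
        ω, e ω * ((o3 ω - a3) * (o4 ω - a4)) ∂μ)) - (Zi * (∫ ω, e ω * ((o1 ω - a1) * (o3 ω - a3)) ∂μ)) * (Zi * (∫ ω, e ω * ((o2 ω - a2) * (o4 ω -
        a4)) ∂μ)) - (Zi * (∫ ω, e ω * ((o1 ω - a1) * (o4 ω - a4)) ∂μ)) * (Zi * (∫ ω, e ω * ((o2 ω - a2) * (o3 ω - a3)) ∂μ))) =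
      ((Zi * (∫ ω, e ω * ((o4 ω - a4) * (o1 ω - a1) * (o2 ω - a2) * (o3 ω - a3)) ∂μ)) - (Zi * (∫ ω, e ω * ((o4 ω - a4) * (o1 ω - a1)) ∂μ)) * (Zi * (∫
          ω, e ω * ((o2 ω - a2) * (o3 ω - a3)) ∂μ)) - (Zi * (∫ ω, e ω * ((o4 ω - a4) * (o2 ω - a2)) ∂μ)) * (Zi * (∫ ω, e ω * ((o1 ω - a1) * (o3 ω -
          a3)) ∂μ)) - (Zi * (∫ ω, e ω * ((o4 ω - a4) * (o3 ω - a3)) ∂μ)) * (Zi * (∫ ω, e ω * ((o1 ω - a1) * (o2 ω - a2)) ∂μ))) := by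
  have i1 : (∫ ω, e ω * ((o1 ω - a1) * (o2 ω - a2) * (o3 ω - a3) * (o4 ω - a4)) ∂μ) =
      (∫ ω, e ω * ((o4 ω - a4) * (o1 ω - a1) * (o2 ω - a2) * (o3 ω - a3)) ∂μ) :=
    integral_congr_ae (Filter.Eventually.of_forall fun ω => by ring)
  have i3 : (∫ ω, e ω * ((o3 ω - a3) * (o4 ω - a4)) ∂μ) =
      (∫ ω, e ω * ((o4 ω - a4) * (o3 ω - a3)) ∂μ) :=
    integral_congr_ae (Filter.Eventually.of_forall fun ω => by ring)
  have i5 : (∫ ω, e ω * ((o2 ω - a2) * (o4 ω - a4)) ∂μ) =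
      (∫ ω, e ω * ((o4 ω - a4) * (o2 ω - a2)) ∂μ) :=
    integral_congr_ae (Filter.Eventually.of_forall fun ω => by ring)
  have i6 : (∫ ω, e ω * ((o1 ω - a1) * (o4 ω - a4)) ∂μ) =
      (∫ ω, e ω * ((o4 ω - a4) * (o1 ω - a1)) ∂μ) :=
    integral_congr_ae (Filter.Eventually.of_forall fun ω => by ring)
  rw [i1, i3, i5, i6]
  ring

/-- **`u₄(p,q,r,w) = u₄(w,q,p,r)`** written out (pointwise). [folklore] -/
theorem u4_4213_pt (μ : Measure Ω) (e : Ω → ℝ) (Zi : ℝ) (o1 o2 o3 o4 : Ω → ℝ) (a1 a2 a3 a4 : ℝ) :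
    ((Zi * (∫ ω, e ω * ((o1 ω - a1) * (o2 ω - a2) * (o3 ω - a3) * (o4 ω - a4)) ∂μ)) - (Zi * (∫ ω, e ω * ((o1 ω - a1) * (o2 ω - a2)) ∂μ)) * (Zi * (∫
        ω, e ω * ((o3 ω - a3) * (o4 ω - a4)) ∂μ)) - (Zi * (∫ ω, e ω * ((o1 ω - a1) * (o3 ω - a3)) ∂μ)) * (Zi * (∫ ω, e ω * ((o2 ω - a2) * (o4 ω -
        a4)) ∂μ)) - (Zi * (∫ ω, e ω * ((o1 ω - a1) * (o4 ω - a4)) ∂μ)) * (Zi * (∫ ω, e ω * ((o2 ω - a2) * (o3 ω - a3)) ∂μ))) =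
      ((Zi * (∫ ω, e ω * ((o4 ω - a4) * (o2 ω - a2) * (o1 ω - a1) * (o3 ω - a3)) ∂μ)) - (Zi * (∫ ω, e ω * ((o4 ω - a4) * (o2 ω - a2)) ∂μ)) * (Zi * (∫
          ω, e ω * ((o1 ω - a1) * (o3 ω - a3)) ∂μ)) - (Zi * (∫ ω, e ω * ((o4 ω - a4) * (o1 ω - a1)) ∂μ)) * (Zi * (∫ ω, e ω * ((o2 ω - a2) * (o3 ω -
          a3)) ∂μ)) - (Zi * (∫ ω, e ω * ((o4 ω - a4) * (o3 ω - a3)) ∂μ)) * (Zi * (∫ ω, e ω * ((o2 ω - a2) * (o1 ω - a1)) ∂μ))) := by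
  have i1 : (∫ ω, e ω * ((o1 ω - a1) * (o2 ω - a2) * (o3 ω - a3) * (o4 ω - a4)) ∂μ) =
      (∫ ω, e ω * ((o4 ω - a4) * (o2 ω - a2) * (o1 ω - a1) * (o3 ω - a3)) ∂μ) :=
    integral_congr_ae (Filter.Eventually.of_forall fun ω => by ring)
  have i2 : (∫ ω, e ω * ((o1 ω - a1) * (o2 ω - a2)) ∂μ) =
      (∫ ω, e ω * ((o2 ω - a2) * (o1 ω - a1)) ∂μ) :=
    integral_congr_ae (Filter.Eventually.of_forall fun ω => by ring)
  have i3 : (∫ ω, e ω * ((o3 ω - a3) * (o4 ω - a4)) ∂μ) =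
      (∫ ω, e ω * ((o4 ω - a4) * (o3 ω - a3)) ∂μ) :=
    integral_congr_ae (Filter.Eventually.of_forall fun ω => by ring)
  have i5 : (∫ ω, e ω * ((o2 ω - a2) * (o4 ω - a4)) ∂μ) =
      (∫ ω, e ω * ((o4 ω - a4) * (o2 ω - a2)) ∂μ) :=
    integral_congr_ae (Filter.Eventually.of_forall fun ω => by ring)
  have i6 : (∫ ω, e ω * ((o1 ω - a1) * (o4 ω - a4)) ∂μ) =
      (∫ ω, e ω * ((o4 ω - a4) * (o1 ω - a1)) ∂μ) :=
    integral_congr_ae (Filter.Eventually.of_forall fun ω => by ring)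
  rw [i1, i2, i3, i5, i6]
  ring

/-- **`u₄(p,q,r,w) = u₄(q,p,r,w)`** written out (pointwise). [folklore] -/
theorem u4_swap12_pt (μ : Measure Ω) (e : Ω → ℝ) (Zi : ℝ) (o1 o2 o3 o4 : Ω → ℝ) (a1 a2 a3 a4 : ℝ) :
    ((Zi * (∫ ω, e ω * ((o1 ω - a1) * (o2 ω - a2) * (o3 ω - a3) * (o4 ω - a4)) ∂μ)) - (Zi * (∫ ω, e ω * ((o1 ω - a1) * (o2 ω - a2)) ∂μ)) * (Zi * (∫
        ω, e ω * ((o3 ω - a3) * (o4 ω - a4)) ∂μ)) - (Zi * (∫ ω, e ω * ((o1 ω - a1) * (o3 ω - a3)) ∂μ)) * (Zi * (∫ ω, e ω * ((o2 ω - a2) * (o4 ω -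
        a4)) ∂μ)) - (Zi * (∫ ω, e ω * ((o1 ω - a1) * (o4 ω - a4)) ∂μ)) * (Zi * (∫ ω, e ω * ((o2 ω - a2) * (o3 ω - a3)) ∂μ))) =
      ((Zi * (∫ ω, e ω * ((o2 ω - a2) * (o1 ω - a1) * (o3 ω - a3) * (o4 ω - a4)) ∂μ)) - (Zi * (∫ ω, e ω * ((o2 ω - a2) * (o1 ω - a1)) ∂μ)) * (Zi * (∫
          ω, e ω * ((o3 ω - a3) * (o4 ω - a4)) ∂μ)) - (Zi * (∫ ω, e ω * ((o2 ω - a2) * (o3 ω - a3)) ∂μ)) * (Zi * (∫ ω, e ω * ((o1 ω - a1) * (o4 ω -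
          a4)) ∂μ)) - (Zi * (∫ ω, e ω * ((o2 ω - a2) * (o4 ω - a4)) ∂μ)) * (Zi * (∫ ω, e ω * ((o1 ω - a1) * (o3 ω - a3)) ∂μ))) := by
  have i1 : (∫ ω, e ω * ((o1 ω - a1) * (o2 ω - a2) * (o3 ω - a3) * (o4 ω - a4)) ∂μ) =
      (∫ ω, e ω * ((o2 ω - a2) * (o1 ω - a1) * (o3 ω - a3) * (o4 ω - a4)) ∂μ) :=
    integral_congr_ae (Filter.Eventually.of_forall fun ω => by ring)
  have i2 : (∫ ω, e ω * ((o1 ω - a1) * (o2 ω - a2)) ∂μ) =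
      (∫ ω, e ω * ((o2 ω - a2) * (o1 ω - a1)) ∂μ) :=
    integral_congr_ae (Filter.Eventually.of_forall fun ω => by ring)
  rw [i1, i2]
  ring

/-- **`u₄(p,q,r,w) = u₄(r,p,q,w)`** written out (pointwise). [folklore] -/
theorem u4_3124_pt (μ : Measure Ω) (e : Ω → ℝ) (Zi : ℝ) (o1 o2 o3 o4 : Ω → ℝ) (a1 a2 a3 a4 : ℝ) :
    ((Zi * (∫ ω, e ω * ((o1 ω - a1) * (o2 ω - a2) * (o3 ω - a3) * (o4 ω - a4)) ∂μ)) - (Zi * (∫ ω, e ω * ((o1 ω - a1) * (o2 ω - a2)) ∂μ)) * (Zi * (∫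
        ω, e ω * ((o3 ω - a3) * (o4 ω - a4)) ∂μ)) - (Zi * (∫ ω, e ω * ((o1 ω - a1) * (o3 ω - a3)) ∂μ)) * (Zi * (∫ ω, e ω * ((o2 ω - a2) * (o4 ω -
        a4)) ∂μ)) - (Zi * (∫ ω, e ω * ((o1 ω - a1) * (o4 ω - a4)) ∂μ)) * (Zi * (∫ ω, e ω * ((o2 ω - a2) * (o3 ω - a3)) ∂μ))) =
      ((Zi * (∫ ω, e ω * ((o3 ω - a3) * (o1 ω - a1) * (o2 ω - a2) * (o4 ω - a4)) ∂μ)) - (Zi * (∫ ω, e ω * ((o3 ω - a3) * (o1 ω - a1)) ∂μ)) * (Zi * (∫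
          ω, e ω * ((o2 ω - a2) * (o4 ω - a4)) ∂μ)) - (Zi * (∫ ω, e ω * ((o3 ω - a3) * (o2 ω - a2)) ∂μ)) * (Zi * (∫ ω, e ω * ((o1 ω - a1) * (o4 ω -
          a4)) ∂μ)) - (Zi * (∫ ω, e ω * ((o3 ω - a3) * (o4 ω - a4)) ∂μ)) * (Zi * (∫ ω, e ω * ((o1 ω - a1) * (o2 ω - a2)) ∂μ))) := by
  have i1 : (∫ ω, e ω * ((o1 ω - a1) * (o2 ω - a2) * (o3 ω - a3) * (o4 ω - a4)) ∂μ) =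
      (∫ ω, e ω * ((o3 ω - a3) * (o1 ω - a1) * (o2 ω - a2) * (o4 ω - a4)) ∂μ) :=
    integral_congr_ae (Filter.Eventually.of_forall fun ω => by ring)
  have i4 : (∫ ω, e ω * ((o1 ω - a1) * (o3 ω - a3)) ∂μ) =
      (∫ ω, e ω * ((o3 ω - a3) * (o1 ω - a1)) ∂μ) :=
    integral_congr_ae (Filter.Eventually.of_forall fun ω => by ring)
  have i7 : (∫ ω, e ω * ((o2 ω - a2) * (o3 ω - a3)) ∂μ) =
      (∫ ω, e ω * ((o3 ω - a3) * (o2 ω - a2)) ∂μ) :=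
    integral_congr_ae (Filter.Eventually.of_forall fun ω => by ring)
  rw [i1, i4, i7]
  ring

/-- **`u₅`, last observable to the front** written out ((578)'s format), pointwise. [folklore] -/
theorem u5_cyc_pt (μ : Measure Ω) (e : Ω → ℝ) (Zi : ℝ) (o1 o2 o3 o4 o5 : Ω → ℝ) (a1 a2 a3 a4 a5 : ℝ) :
    ((Zi * (∫ ω, e ω * ((o1 ω - a1) * (o2 ω - a2) * (o3 ω - a3) * (o4 ω - a4) * (o5 ω - a5)) ∂μ)) -
        ((Zi * (∫ ω, e ω * ((o1 ω - a1) * (o2 ω - a2)) ∂μ)) * (Zi * (∫ ω, e ω * ((o3 ω - a3) * (o4 ω - a4) * (o5 ω - a5)) ∂μ)) +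
        (Zi * (∫ ω, e ω * ((o1 ω - a1) * (o3 ω - a3)) ∂μ)) * (Zi * (∫ ω, e ω * ((o2 ω - a2) * (o4 ω - a4) * (o5 ω - a5)) ∂μ)) +
        (Zi * (∫ ω, e ω * ((o1 ω - a1) * (o4 ω - a4)) ∂μ)) * (Zi * (∫ ω, e ω * ((o2 ω - a2) * (o3 ω - a3) * (o5 ω - a5)) ∂μ)) +
        (Zi * (∫ ω, e ω * ((o1 ω - a1) * (o5 ω - a5)) ∂μ)) * (Zi * (∫ ω, e ω * ((o2 ω - a2) * (o3 ω - a3) * (o4 ω - a4)) ∂μ)) +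
        (Zi * (∫ ω, e ω * ((o2 ω - a2) * (o3 ω - a3)) ∂μ)) * (Zi * (∫ ω, e ω * ((o1 ω - a1) * (o4 ω - a4) * (o5 ω - a5)) ∂μ)) +
        (Zi * (∫ ω, e ω * ((o2 ω - a2) * (o4 ω - a4)) ∂μ)) * (Zi * (∫ ω, e ω * ((o1 ω - a1) * (o3 ω - a3) * (o5 ω - a5)) ∂μ)) +
        (Zi * (∫ ω, e ω * ((o2 ω - a2) * (o5 ω - a5)) ∂μ)) * (Zi * (∫ ω, e ω * ((o1 ω - a1) * (o3 ω - a3) * (o4 ω - a4)) ∂μ)) +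
        (Zi * (∫ ω, e ω * ((o3 ω - a3) * (o4 ω - a4)) ∂μ)) * (Zi * (∫ ω, e ω * ((o1 ω - a1) * (o2 ω - a2) * (o5 ω - a5)) ∂μ)) +
        (Zi * (∫ ω, e ω * ((o3 ω - a3) * (o5 ω - a5)) ∂μ)) * (Zi * (∫ ω, e ω * ((o1 ω - a1) * (o2 ω - a2) * (o4 ω - a4)) ∂μ)) +
        (Zi * (∫ ω, e ω * ((o4 ω - a4) * (o5 ω - a5)) ∂μ)) * (Zi * (∫ ω, e ω * ((o1 ω - a1) * (o2 ω - a2) * (o3 ω - a3)) ∂μ)))) =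
      ((Zi * (∫ ω, e ω * ((o5 ω - a5) * (o1 ω - a1) * (o2 ω - a2) * (o3 ω - a3) * (o4 ω - a4)) ∂μ)) -
        ((Zi * (∫ ω, e ω * ((o5 ω - a5) * (o1 ω - a1)) ∂μ)) * (Zi * (∫ ω, e ω * ((o2 ω - a2) * (o3 ω - a3) * (o4 ω - a4)) ∂μ)) +
        (Zi * (∫ ω, e ω * ((o5 ω - a5) * (o2 ω - a2)) ∂μ)) * (Zi * (∫ ω, e ω * ((o1 ω - a1) * (o3 ω - a3) * (o4 ω - a4)) ∂μ)) +
        (Zi * (∫ ω, e ω * ((o5 ω - a5) * (o3 ω - a3)) ∂μ)) * (Zi * (∫ ω, e ω * ((o1 ω - a1) * (o2 ω - a2) * (o4 ω - a4)) ∂μ)) +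
        (Zi * (∫ ω, e ω * ((o5 ω - a5) * (o4 ω - a4)) ∂μ)) * (Zi * (∫ ω, e ω * ((o1 ω - a1) * (o2 ω - a2) * (o3 ω - a3)) ∂μ)) +
        (Zi * (∫ ω, e ω * ((o1 ω - a1) * (o2 ω - a2)) ∂μ)) * (Zi * (∫ ω, e ω * ((o5 ω - a5) * (o3 ω - a3) * (o4 ω - a4)) ∂μ)) +
        (Zi * (∫ ω, e ω * ((o1 ω - a1) * (o3 ω - a3)) ∂μ)) * (Zi * (∫ ω, e ω * ((o5 ω - a5) * (o2 ω - a2) * (o4 ω - a4)) ∂μ)) +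
        (Zi * (∫ ω, e ω * ((o1 ω - a1) * (o4 ω - a4)) ∂μ)) * (Zi * (∫ ω, e ω * ((o5 ω - a5) * (o2 ω - a2) * (o3 ω - a3)) ∂μ)) +
        (Zi * (∫ ω, e ω * ((o2 ω - a2) * (o3 ω - a3)) ∂μ)) * (Zi * (∫ ω, e ω * ((o5 ω - a5) * (o1 ω - a1) * (o4 ω - a4)) ∂μ)) +
        (Zi * (∫ ω, e ω * ((o2 ω - a2) * (o4 ω - a4)) ∂μ)) * (Zi * (∫ ω, e ω * ((o5 ω - a5) * (o1 ω - a1) * (o3 ω - a3)) ∂μ)) +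
        (Zi * (∫ ω, e ω * ((o3 ω - a3) * (o4 ω - a4)) ∂μ)) * (Zi * (∫ ω, e ω * ((o5 ω - a5) * (o1 ω - a1) * (o2 ω - a2)) ∂μ)))) := by
  have i1 : (∫ ω, e ω * ((o1 ω - a1) * (o2 ω - a2) * (o3 ω - a3) * (o4 ω - a4) * (o5 ω - a5)) ∂μ) =
      (∫ ω, e ω * ((o5 ω - a5) * (o1 ω - a1) * (o2 ω - a2) * (o3 ω - a3) * (o4 ω - a4)) ∂μ) :=
    integral_congr_ae (Filter.Eventually.of_forall fun ω => by ring)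
  have i3 : (∫ ω, e ω * ((o3 ω - a3) * (o4 ω - a4) * (o5 ω - a5)) ∂μ) =
      (∫ ω, e ω * ((o5 ω - a5) * (o3 ω - a3) * (o4 ω - a4)) ∂μ) :=
    integral_congr_ae (Filter.Eventually.of_forall fun ω => by ring)
  have i5 : (∫ ω, e ω * ((o2 ω - a2) * (o4 ω - a4) * (o5 ω - a5)) ∂μ) =
      (∫ ω, e ω * ((o5 ω - a5) * (o2 ω - a2) * (o4 ω - a4)) ∂μ) :=
    integral_congr_ae (Filter.Eventually.of_forall fun ω => by ring)
  have i7 : (∫ ω, e ω * ((o2 ω - a2) * (o3 ω - a3) * (o5 ω - a5)) ∂μ) =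
      (∫ ω, e ω * ((o5 ω - a5) * (o2 ω - a2) * (o3 ω - a3)) ∂μ) :=
    integral_congr_ae (Filter.Eventually.of_forall fun ω => by ring)
  have i8 : (∫ ω, e ω * ((o1 ω - a1) * (o5 ω - a5)) ∂μ) =
      (∫ ω, e ω * ((o5 ω - a5) * (o1 ω - a1)) ∂μ) :=
    integral_congr_ae (Filter.Eventually.of_forall fun ω => by ring)
  have i11 : (∫ ω, e ω * ((o1 ω - a1) * (o4 ω - a4) * (o5 ω - a5)) ∂μ) =
      (∫ ω, e ω * ((o5 ω - a5) * (o1 ω - a1) * (o4 ω - a4)) ∂μ) :=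
    integral_congr_ae (Filter.Eventually.of_forall fun ω => by ring)
  have i13 : (∫ ω, e ω * ((o1 ω - a1) * (o3 ω - a3) * (o5 ω - a5)) ∂μ) =
      (∫ ω, e ω * ((o5 ω - a5) * (o1 ω - a1) * (o3 ω - a3)) ∂μ) :=
    integral_congr_ae (Filter.Eventually.of_forall fun ω => by ring)
  have i14 : (∫ ω, e ω * ((o2 ω - a2) * (o5 ω - a5)) ∂μ) =
      (∫ ω, e ω * ((o5 ω - a5) * (o2 ω - a2)) ∂μ) :=
    integral_congr_ae (Filter.Eventually.of_forall fun ω => by ring)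
  have i17 : (∫ ω, e ω * ((o1 ω - a1) * (o2 ω - a2) * (o5 ω - a5)) ∂μ) =
      (∫ ω, e ω * ((o5 ω - a5) * (o1 ω - a1) * (o2 ω - a2)) ∂μ) :=
    integral_congr_ae (Filter.Eventually.of_forall fun ω => by ring)
  have i18 : (∫ ω, e ω * ((o3 ω - a3) * (o5 ω - a5)) ∂μ) =
      (∫ ω, e ω * ((o5 ω - a5) * (o3 ω - a3)) ∂μ) :=
    integral_congr_ae (Filter.Eventually.of_forall fun ω => by ring)
  have i20 : (∫ ω, e ω * ((o4 ω - a4) * (o5 ω - a5)) ∂μ) =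
      (∫ ω, e ω * ((o5 ω - a5) * (o4 ω - a4)) ∂μ) :=
    integral_congr_ae (Filter.Eventually.of_forall fun ω => by ring)
  rw [i1, i3, i5, i7, i8, i11, i13, i14, i17, i18, i20]
  ring

/-- Toy (the mechanism): two integrands that agree pointwise by commutativity have the same integral. -/
example (μ : Measure Ω) (f g : Ω → ℝ) : ∫ ω, f ω * g ω ∂μ = ∫ ω, g ω * f ω ∂μ :=
  integral_congr_ae (Filter.Eventually.of_forall fun ω => by ring)

end Summit.QuantumFields.BalabanUV.T4Continuum.NE7b.SupFifthKernelEntryGlue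

end
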